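import Summits.Ventures.GridStability.Models.WSCC9
import Literature.Analysis.ODE.LipschitzFlow
import HarnessLib

/-!
# GridStability/Models/ClassicalSwingGlobal — the classical network-reduced multimachine field WITH transfer
# conductances is globally Lipschitz: global existence and uniqueness of solutions (every machine state)

Cell `gridfusion` (LADDER-GRIDFUSION, G2.c lossy tier); seat gridfusion-lyap-2 (g0), rider material (lyap-2
INTENT 09:3xZ; no count). Twin, for model-1's network-reduced classical model `ClassicalSwing n`
(`Models/ClassicalSwing.lean`, p459650: `δ̇ᵢ = ωᵢ`, `ω̇ᵢ = (Pᵢ − P_ei(δ) − Dᵢωᵢ)/Mᵢ`,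
`P_ei(δ) = Eᵢ²Gᵢᵢ + Σ_{j≠i}(Cᵢⱼ sin δᵢⱼ + Dᵢⱼ cos δᵢⱼ)` — transfer conductances KEPT), of model-2's
`Models/StructurePreservingGlobal.lean` (MV-3). WHY: every lossy-tier region sentence of the cell
(`WSCC9.lurie_roa` p493501, lane V `WSCC9LossySlab.lossy_slab_roa` p516091, lane F1
`Bench.WSCC9LossySplitSlab.lossy_split_slab_roa` p516717, model-1's `WSCC9.lossy_split_roa` p508678) is an
A-PRIORI statement «for every solution `c` of `postB_SPdamp.toModel` on `univ` …»; this file supplies the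
solutions: through EVERY machine state passes exactly one solution defined for all times, so those
sentences are never vacuous and speak about «the» trajectory.

CONTENTS (all PROVED, no certificate, no named fact; any `n`, any data — a zero `Mᵢ` makes the
corresponding acceleration identically `0` in Lean's `x/0 = 0` convention and the estimates still hold):
* `absCoupling p i = Σ_{j≠i} (|Cᵢⱼ| + |Dᵢⱼ|)`; `abs_Pe_sub_Pe_le` — the electrical powers are Lipschitz in
  the angles, `|P_ei(δ) − P_ei(δ′)| ≤ 2·absCoupling·dist(δ, δ′)` (`|sin a − sin b|, |cos a − cos b| ≤ |a − b|`);
* `lipConst p = 1 + Σᵢ (|Dᵢ| + 2·absCouplingᵢ)/|Mᵢ|`, `dist_field_le`, `lipschitzWith_field` — model-1's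
  `ClassicalSwing.field` is globally Lipschitz for the sup metric on `State n = (Fin n → ℝ) × (Fin n → ℝ)`;
* `exists_solution` — `∀ x, ∃ c, c 0 = x ∧ ∀ t, HasDerivAt c (p.field (c t)) t`
  (`Literature.Analysis.ODE.exists_solution_real_of_lipschitz`); `exists_isSolutionOn_univ` — the same in
  the tree convention `p.IsSolutionOn c univ`; `isSolutionOn_univ_iff` (on `univ` the two conventions agree);
* `eq_lipschitzFlow_of_isSolutionOn_univ`, `isSolutionOn_univ_unique` — every solution on `univ` IS the
  flow curve `Literature.Analysis.ODE.lipschitzFlow` of its initial state; two solutions on `univ` with the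
  same initial state are equal (Lang IV §1 Thm 1.3);
* instance «WSCC9-postB-SPdamp-h12»: `WSCC9.postB_SPdamp_exists_solution`, `WSCC9.postB_SPdamp_solution_unique`.
THREE COLUMNS. MODELLED column only (model MV-2 (+ MV-P + MV-SPD + MV-ω + MV-h12 for the instance)): a
statement about the ODE model, not about a grid; nothing here is a certificate; no sentence says a grid is
stable. [cite: Hartman2002, Ch. III Thm. 5.1 with Remark 1; SauerPai1998, §7.9.3 eqs. (7.212)–(7.216)]
-/

noncomputable section

open Finset Real Set

namespace Summit.Ventures.GridStability.Models

namespace ClassicalSwing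

variable {n : ℕ} (p : ClassicalSwing n)

/-! ## The electrical powers are Lipschitz in the angles -/

/-- Row sum of the absolute couplings at machine `i`: `Σ_{j ≠ i} (|Cᵢⱼ| + |Dᵢⱼ|)`. -/
def absCoupling (i : Fin n) : ℝ := ∑ j ∈ univ.erase i, (|p.Ccoef i j| + |p.Dcoef i j|)

/-- `absCoupling` is nonnegative. -/
theorem absCoupling_nonneg (i : Fin n) : 0 ≤ p.absCoupling i :=
  Finset.sum_nonneg fun _ _ => add_nonneg (abs_nonneg _) (abs_nonneg _)

/-- **The electrical powers are Lipschitz in the angles**: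
`|P_ei(δ) − P_ei(δ′)| ≤ 2·(Σ_{j≠i}(|Cᵢⱼ| + |Dᵢⱼ|))·dist(δ, δ′)` (each coupling term moves by at most
`(|Cᵢⱼ| + |Dᵢⱼ|)·|(δᵢ − δⱼ) − (δ′ᵢ − δ′ⱼ)| ≤ 2(|Cᵢⱼ| + |Dᵢⱼ|)·dist(δ, δ′)`, by `|sin a − sin b| ≤ |a − b|` and
`|cos a − cos b| ≤ |a − b|`). [cite: SauerPai1998, §7.9.3 eq. (7.212)] -/
theorem abs_Pe_sub_Pe_le (δ δ' : Fin n → ℝ) (i : Fin n) :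
    |p.Pe δ i - p.Pe δ' i| ≤ 2 * p.absCoupling i * dist δ δ' := by
  have hd : ∀ j, |δ j - δ' j| ≤ dist δ δ' := fun j => by
    rw [← Real.dist_eq]; exact dist_le_pi_dist δ δ' j
  have hsub : p.Pe δ i - p.Pe δ' i
      = ∑ j ∈ univ.erase i, (p.Ccoef i j * (Real.sin (δ i - δ j) - Real.sin (δ' i - δ' j))
          + p.Dcoef i j * (Real.cos (δ i - δ j) - Real.cos (δ' i - δ' j))) := by
    simp only [Pe, add_sub_add_left_eq_sub, ← Finset.sum_sub_distrib]
    refine Finset.sum_congr rfl fun j _ => ?_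
    ring
  rw [hsub, absCoupling, Finset.mul_sum, Finset.sum_mul]
  refine (Finset.abs_sum_le_sum_abs _ _).trans (Finset.sum_le_sum fun j _ => ?_)
  have harg : |(δ i - δ j) - (δ' i - δ' j)| ≤ 2 * dist δ δ' := by
    rw [show (δ i - δ j) - (δ' i - δ' j) = (δ i - δ' i) - (δ j - δ' j) by ring]
    exact (abs_sub _ _).trans (by linarith [hd i, hd j])
  have h1 : |Real.sin (δ i - δ j) - Real.sin (δ' i - δ' j)| ≤ 2 * dist δ δ' :=
    (Real.abs_sin_sub_sin_le _ _).trans harg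
  have h2 : |Real.cos (δ i - δ j) - Real.cos (δ' i - δ' j)| ≤ 2 * dist δ δ' :=
    (Real.abs_cos_sub_cos_le _ _).trans harg
  calc |p.Ccoef i j * (Real.sin (δ i - δ j) - Real.sin (δ' i - δ' j))
          + p.Dcoef i j * (Real.cos (δ i - δ j) - Real.cos (δ' i - δ' j))|
      ≤ |p.Ccoef i j| * |Real.sin (δ i - δ j) - Real.sin (δ' i - δ' j)|
          + |p.Dcoef i j| * |Real.cos (δ i - δ j) - Real.cos (δ' i - δ' j)| := by
        refine (abs_add_le _ _).trans ?_
        rw [abs_mul, abs_mul]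
    _ ≤ |p.Ccoef i j| * (2 * dist δ δ') + |p.Dcoef i j| * (2 * dist δ δ') :=
        add_le_add (mul_le_mul_of_nonneg_left h1 (abs_nonneg _))
          (mul_le_mul_of_nonneg_left h2 (abs_nonneg _))
    _ = 2 * (|p.Ccoef i j| + |p.Dcoef i j|) * dist δ δ' := by ring

/-! ## A global Lipschitz constant of the field -/

/-- An explicit global Lipschitz constant of `p.field` for the sup metric:
`1 + Σᵢ (|Dᵢ| + 2·absCouplingᵢ)/|Mᵢ|` (a term with `Mᵢ = 0` is `0`, matching the field, whose acceleration
component is then constant). -/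
def lipConst : ℝ := 1 + ∑ i, (|p.D i| + 2 * p.absCoupling i) / |p.M i|

/-- The summands of `lipConst` are nonnegative. -/
theorem lipConst_term_nonneg (i : Fin n) : 0 ≤ (|p.D i| + 2 * p.absCoupling i) / |p.M i| := by
  have := p.absCoupling_nonneg i
  positivity

/-- `1 ≤ lipConst`. -/
theorem one_le_lipConst : 1 ≤ p.lipConst := by
  have := Finset.sum_nonneg fun i (_ : i ∈ (univ : Finset (Fin n))) => p.lipConst_term_nonneg i
  unfold lipConst
  linarith

/-- Each per-machine acceleration constant is below `lipConst`. -/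
theorem accConst_le_lipConst (i : Fin n) : (|p.D i| + 2 * p.absCoupling i) / |p.M i| ≤ p.lipConst := by
  have hle := Finset.single_le_sum (f := fun i => (|p.D i| + 2 * p.absCoupling i) / |p.M i|)
    (fun i _ => p.lipConst_term_nonneg i) (Finset.mem_univ i)
  unfold lipConst
  linarith

/-- Angle-rate components (`= ωᵢ`) are `lipConst`-Lipschitz. -/
theorem abs_field_fst_sub_le (z z' : State n) (i : Fin n) :
    |(p.field z).1 i - (p.field z').1 i| ≤ p.lipConst * dist z z' := by
  have hd : 0 ≤ dist z z' := dist_nonneg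
  have h2 : dist z.2 z'.2 ≤ dist z z' := by rw [Prod.dist_eq]; exact le_max_right _ _
  have h : |z.2 i - z'.2 i| ≤ dist z z' := by
    rw [← Real.dist_eq]; exact (dist_le_pi_dist z.2 z'.2 i).trans h2
  show |z.2 i - z'.2 i| ≤ p.lipConst * dist z z'
  calc |z.2 i - z'.2 i| ≤ dist z z' := h
    _ = 1 * dist z z' := (one_mul _).symm
    _ ≤ p.lipConst * dist z z' := mul_le_mul_of_nonneg_right p.one_le_lipConst hd

/-- Acceleration components are `lipConst`-Lipschitz. -/
theorem abs_field_snd_sub_le (z z' : State n) (i : Fin n) :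
    |(p.field z).2 i - (p.field z').2 i| ≤ p.lipConst * dist z z' := by
  have hd : 0 ≤ dist z z' := dist_nonneg
  have h1 : dist z.1 z'.1 ≤ dist z z' := by rw [Prod.dist_eq]; exact le_max_left _ _
  have h2 : dist z.2 z'.2 ≤ dist z z' := by rw [Prod.dist_eq]; exact le_max_right _ _
  have hω : |z.2 i - z'.2 i| ≤ dist z z' := by
    rw [← Real.dist_eq]; exact (dist_le_pi_dist z.2 z'.2 i).trans h2
  have hpe := (p.abs_Pe_sub_Pe_le z.1 z'.1 i).trans
    (mul_le_mul_of_nonneg_left h1 (by have := p.absCoupling_nonneg i; positivity))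
  show |(p.P i - p.Pe z.1 i - p.D i * z.2 i) / p.M i - (p.P i - p.Pe z'.1 i - p.D i * z'.2 i) / p.M i|
      ≤ p.lipConst * dist z z'
  rw [← sub_div, abs_div]
  have hnum : |p.P i - p.Pe z.1 i - p.D i * z.2 i - (p.P i - p.Pe z'.1 i - p.D i * z'.2 i)|
      ≤ (|p.D i| + 2 * p.absCoupling i) * dist z z' := by
    rw [show p.P i - p.Pe z.1 i - p.D i * z.2 i - (p.P i - p.Pe z'.1 i - p.D i * z'.2 i)
      = -(p.D i * (z.2 i - z'.2 i)) + -(p.Pe z.1 i - p.Pe z'.1 i) by ring]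
    refine (abs_add_le _ _).trans ?_
    rw [abs_neg, abs_neg, abs_mul, add_mul]
    exact add_le_add (mul_le_mul_of_nonneg_left hω (abs_nonneg _)) hpe
  calc |p.P i - p.Pe z.1 i - p.D i * z.2 i - (p.P i - p.Pe z'.1 i - p.D i * z'.2 i)| / |p.M i|
      ≤ (|p.D i| + 2 * p.absCoupling i) * dist z z' / |p.M i| :=
        div_le_div_of_nonneg_right hnum (abs_nonneg _)
    _ = ((|p.D i| + 2 * p.absCoupling i) / |p.M i|) * dist z z' := by ring
    _ ≤ p.lipConst * dist z z' := mul_le_mul_of_nonneg_right (p.accConst_le_lipConst i) hd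

/-- **The field is globally Lipschitz** (sup metric): `dist(F z, F z′) ≤ lipConst·dist(z, z′)`. -/
theorem dist_field_le (z z' : State n) : dist (p.field z) (p.field z') ≤ p.lipConst * dist z z' := by
  have hK : 0 ≤ p.lipConst * dist z z' := mul_nonneg (zero_le_one.trans p.one_le_lipConst) dist_nonneg
  rw [Prod.dist_eq, max_le_iff, dist_pi_le_iff hK, dist_pi_le_iff hK]
  exact ⟨fun i => by rw [Real.dist_eq]; exact p.abs_field_fst_sub_le z z' i,
    fun i => by rw [Real.dist_eq]; exact p.abs_field_snd_sub_le z z' i⟩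

/-- **The field is globally Lipschitz** (as a `LipschitzWith` fact). -/
theorem lipschitzWith_field : LipschitzWith (Real.toNNReal p.lipConst) p.field :=
  LipschitzWith.of_dist_le' fun z z' => p.dist_field_le z z'

/-! ## Global existence and uniqueness of solutions -/

/-- **Through every machine state passes a solution of `M_cl` defined for all times**: for every `x` there
is `c : ℝ → State n` with `c 0 = x` and `c′(t) = F(c t)` for every `t ∈ ℝ` (global Lipschitz field ⇒ no
finite-time blow-up). [cite: Hartman2002, Ch. III Thm. 5.1 with Remark 1] -/
theorem exists_solution (x : State n) : ∃ c : ℝ → State n, c 0 = x ∧ ∀ t, HasDerivAt c (p.field (c t)) t :=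
  Literature.Analysis.ODE.exists_solution_real_of_lipschitz p.lipschitzWith_field x

/-- On `univ` the tree's solution convention is the plain one: `IsSolutionOn c univ ↔ ∀ t, HasDerivAt`. -/
theorem isSolutionOn_univ_iff (c : ℝ → State n) :
    p.IsSolutionOn c univ ↔ ∀ t, HasDerivAt c (p.field (c t)) t := by
  simp only [IsSolutionOn, mem_univ, forall_const, hasDerivWithinAt_univ]

/-- **Global existence in the tree's solution convention**: from every machine state `x` there is a
solution `c` of `M_cl` on `univ` with `c 0 = x` — the shape the a-priori region-of-attraction sentences
(`WSCC9.lurie_roa`, `WSCC9.lossy_split_roa`, the #35 lane sentences) quantify over, so they are never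
vacuous. [cite: Hartman2002, Ch. III Thm. 5.1 with Remark 1] -/
theorem exists_isSolutionOn_univ (x : State n) : ∃ c : ℝ → State n, c 0 = x ∧ p.IsSolutionOn c univ := by
  obtain ⟨c, h0, hc⟩ := p.exists_solution x
  exact ⟨c, h0, (p.isSolutionOn_univ_iff c).2 hc⟩

/-- **Every solution on `univ` IS the flow curve of its initial state** (`Literature.Analysis.ODE.lipschitzFlow`
of the Lipschitz field). [cite: Lang1995, Ch. IV §1, Thm. 1.3] -/
theorem eq_lipschitzFlow_of_isSolutionOn_univ {c : ℝ → State n} (hc : p.IsSolutionOn c univ) (t : ℝ) :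
    c t = Literature.Analysis.ODE.lipschitzFlow p.lipschitzWith_field (c 0) t := by
  have hc' := (p.isSolutionOn_univ_iff c).1 hc
  have h := Literature.Analysis.ODE.eqOn_lipschitzFlow p.lipschitzWith_field (γ := c)
    (a := -(|t| + 1)) (b := |t| + 1) ⟨by linarith [abs_nonneg t], by linarith [abs_nonneg t]⟩
    (fun s _ => hc' s)
  exact h ⟨by linarith [neg_abs_le t], by linarith [le_abs_self t]⟩

/-- **Uniqueness**: two solutions of `M_cl` on `univ` with the same initial state are equal — with
`exists_isSolutionOn_univ`, through every machine state there is EXACTLY ONE trajectory.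
[cite: Lang1995, Ch. IV §1, Thm. 1.3; Hartman2002, Ch. III Thm. 5.1] -/
theorem isSolutionOn_univ_unique {c c' : ℝ → State n} (hc : p.IsSolutionOn c univ)
    (hc' : p.IsSolutionOn c' univ) (h0 : c 0 = c' 0) : c = c' := by
  funext t
  rw [p.eq_lipschitzFlow_of_isSolutionOn_univ hc t, p.eq_lipschitzFlow_of_isSolutionOn_univ hc' t, h0]

end ClassicalSwing

/-! ## Instance of record «WSCC9-postB-SPdamp-h12» (transfer conductances KEPT) -/

namespace WSCC9

/-- **From every machine state there is a solution of the printed post-fault-B classical model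
`WSCC9.postB_SPdamp.toModel` (transfer conductances KEPT, `D/M = 1/10, 1/5, 3/10`) on all of `ℝ`** — the
curves the a-priori sentences `lurie_roa` / `lossy_split_roa` / lane V / lane F1 speak about.
MODELLED «WSCC9-postB-SPdamp-h12»; no certificate; nothing here says a grid is stable.
[cite: Hartman2002, Ch. III Thm. 5.1 with Remark 1] -/
theorem postB_SPdamp_exists_solution (x : ClassicalSwing.State 3) :
    ∃ c : ℝ → ClassicalSwing.State 3, c 0 = x ∧ postB_SPdamp.toModel.IsSolutionOn c univ :=
  postB_SPdamp.toModel.exists_isSolutionOn_univ x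

/-- **… and only one**: two solutions of `WSCC9.postB_SPdamp.toModel` on `univ` with the same initial
machine state coincide. [cite: Lang1995, Ch. IV §1, Thm. 1.3] -/
theorem postB_SPdamp_solution_unique {c c' : ℝ → ClassicalSwing.State 3}
    (hc : postB_SPdamp.toModel.IsSolutionOn c univ) (hc' : postB_SPdamp.toModel.IsSolutionOn c' univ)
    (h0 : c 0 = c' 0) : c = c' :=
  postB_SPdamp.toModel.isSolutionOn_univ_unique hc hc' h0

end WSCC9

end Summit.Ventures.GridStability.Models

end
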